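import Summits.CriticalPhenomena.PercolationContinuityZ3.Theorems.PercNearOneGluingNoHeavyLowerTailStarSetSupplyU0Pairs
import Summits.CriticalPhenomena.PercolationContinuityZ3.Theorems.PercNearOneGluingNoHeavyLowerTailStarSetSupplyReduction
import Summits.CriticalPhenomena.PercolationContinuityZ3.Theorems.PercNearOneGluingNoHeavyLowerTailStarSetNestedCertificateCore
import HarnessLib

/-!
# `NoHeavyLowerTail` (stmt-CriticalPhenomena-4575) — ★ the supply inequality U0' of the MWF certificate, PROVED (MWF-CERT §5)

Support file (prover `prim-gen-swap` gen 9; `--supports stmt-CriticalPhenomena-4575`).  No definitions, no named facts, no sorries.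

`StarSet.mwf_supply_U0` discharges the hypothesis `hU0` of `StarSet.setCS_twoPortStarMultigraph_mixed_levelTwo` (…StarSetMixedLevelTwo) for every
two-port star multigraph whose classes are split into a forest part (`Fin.castAdd Mc I`) and chords (`Fin.natAdd Mf K`) such that every chord is
DOMINATED at each of its two ports by an adjacent forest class whose other port is off the chord (`hdomF`; true for the fundamental-cycle
successors of a maximum-weight spanning forest of the class graph):
  `coef(e₀)·(Σ_I c_I + Σ_K Θ_K Zfar_K) ≤ coef(e₀) + Σ_{|R_e| ≥ 3} coef(e)`.
Proof = MWF-CERT §5: telescoping (`nestedCoeff_sum`), second-order reduction at class level (`supply_second_order_reduction` with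
`Cr` = chords, `F` = forest, `Ch = ∅`), class weights ≤ star sums, and `StarSet.pairs_supply_le_budget`.
The companion `hU1` (U1'_r) remains open (MWF-CERT §7).
-/

noncomputable section

namespace Summit.CriticalPhenomena.PercolationContinuityZ3.Theorems

open Finset
open scoped Classical BigOperators

namespace StarSet

variable {n m Mf Mc : ℕ}

/-- **U0' for locally dominated chords.**  See the file header. [MWF-CERT.md §5] -/
theorem mwf_supply_U0 (w : Sym2 (Fin n) → unitInterval) (s p p' : Fin m → Fin n)
    (cls : Fin m → Fin (Mf + Mc)) (P P' : Fin (Mf + Mc) → Fin n) (hP : ∀ i, p i = P (cls i)) (hP' : ∀ i, p' i = P' (cls i))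
    (hPP' : ∀ κ, P κ ≠ P' κ)
    (hnopar : ∀ I K : Fin (Mf + Mc), I ≠ K → ¬ ((P K = P I ∨ P K = P' I) ∧ (P' K = P I ∨ P' K = P' I)))
    (hdomF : ∀ K : Fin Mc, ∀ d : Fin n, (d = P (Fin.natAdd Mf K) ∨ d = P' (Fin.natAdd Mf K)) →
      ∃ I : Fin Mf, (P (Fin.castAdd Mc I) = d ∨ P' (Fin.castAdd Mc I) = d) ∧
        (P (Fin.castAdd Mc I) ∉ ({P (Fin.natAdd Mf K), P' (Fin.natAdd Mf K)} : Finset (Fin n)) ∨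
          P' (Fin.castAdd Mc I) ∉ ({P (Fin.natAdd Mf K), P' (Fin.natAdd Mf K)} : Finset (Fin n))) ∧
        ∏ i ∈ Finset.univ.filter (fun i => cls i = Fin.castAdd Mc I), (1 - (w s(s i, p i) : ℝ) * w s(s i, p' i)) ≤
          ∏ i ∈ Finset.univ.filter (fun i => cls i = Fin.natAdd Mf K), (1 - (w s(s i, p i) : ℝ) * w s(s i, p' i))) :
    (∏ i, (if (w s(s i, p i) : ℝ) * w s(s i, p' i) < 1 then
          ((1 - (w s(s i, p i) : ℝ)) * (1 - w s(s i, p' i))) / (1 - (w s(s i, p i) : ℝ) * w s(s i, p' i)) else 0)) *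
        (∑ I : Fin Mf, ((1 - ∏ i ∈ Finset.univ.filter (fun i => cls i = Fin.castAdd Mc I), (1 - (w s(s i, p i) : ℝ) * w s(s i, p' i))) *
          ∏ K ∈ Finset.univ.filter (· < I), ∏ i ∈ Finset.univ.filter (fun i => cls i = Fin.castAdd Mc K), (1 - (w s(s i, p i) : ℝ) * w s(s i, p' i))) +
        ∑ K : Fin Mc, ((1 - ∏ i ∈ Finset.univ.filter (fun i => cls i = Fin.natAdd Mf K), (1 - (w s(s i, p i) : ℝ) * w s(s i, p' i))) *
          ∏ κ' ∈ Finset.univ.filter (fun κ' => ¬ (P κ' = P (Fin.natAdd Mf K) ∨ P κ' = P' (Fin.natAdd Mf K) ∨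
              P' κ' = P (Fin.natAdd Mf K) ∨ P' κ' = P' (Fin.natAdd Mf K))),
            ∏ i ∈ Finset.univ.filter (fun i => cls i = κ'), (1 - (w s(s i, p i) : ℝ) * w s(s i, p' i)))) ≤
      (∏ i, (if (w s(s i, p i) : ℝ) * w s(s i, p' i) < 1 then
          ((1 - (w s(s i, p i) : ℝ)) * (1 - w s(s i, p' i))) / (1 - (w s(s i, p i) : ℝ) * w s(s i, p' i)) else 0)) +
      ∑ e : Fin m → Fin 3, (if 3 ≤ ((Finset.univ.filter fun i => e i = 1).image p ∪ (Finset.univ.filter fun i => e i = 2).image p').card then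
        ∏ i, (if (w s(s i, p i) : ℝ) * w s(s i, p' i) < 1 then
            ((if e i = 1 then (w s(s i, p i) : ℝ) else 1 - w s(s i, p i)) *
              (if e i = 2 then (w s(s i, p' i) : ℝ) else 1 - w s(s i, p' i))) / (1 - (w s(s i, p i) : ℝ) * w s(s i, p' i))
          else if e i = 1 then 1 else 0) else 0) := by
  -- (0) abbreviations
  set θ : Fin m → ℝ := fun i => (w s(s i, p i) : ℝ) * w s(s i, p' i) with hθ
  have hθ0 : ∀ i, 0 ≤ θ i := fun i => mul_nonneg (w _).2.1 (w _).2.1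
  have hθ1 : ∀ i, θ i ≤ 1 := fun i => mul_le_one₀ (w _).2.2 (w _).2.1 (w _).2.2
  set St : Fin (Mf + Mc) → Finset (Fin m) := fun κ => univ.filter (fun i => cls i = κ) with hSt
  set uu : Fin (Mf + Mc) → ℝ := fun κ => ∏ i ∈ univ.filter (fun i => cls i = κ), (1 - θ i) with huu
  have huu0 : ∀ κ, 0 ≤ uu κ := fun κ => prod_nonneg fun i _ => sub_nonneg.2 (hθ1 i)
  have huu1 : ∀ κ, uu κ ≤ 1 := fun κ => prod_le_one (fun i _ => sub_nonneg.2 (hθ1 i)) fun i _ => sub_le_self _ (hθ0 i)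
  set touch : Fin (Mf + Mc) → Fin (Mf + Mc) → Prop := fun κ' κ => P κ' = P κ ∨ P κ' = P' κ ∨ P' κ' = P κ ∨ P' κ' = P' κ with htouch
  set D : Fin Mc → ℝ := fun K => (1 - uu (Fin.natAdd Mf K)) *
    ∏ κ' ∈ univ.filter (fun κ' => ¬ touch κ' (Fin.natAdd Mf K)), uu κ' with hD
  have hDnn : ∀ K, 0 ≤ D K := fun K => mul_nonneg (sub_nonneg.2 (huu1 _)) (prod_nonneg fun κ' _ => huu0 κ')
  have hDle : ∀ K, D K ≤ 1 - uu (Fin.natAdd Mf K) := fun K => by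
    have h := prod_le_one (s := univ.filter (fun κ' => ¬ touch κ' (Fin.natAdd Mf K))) (f := fun κ' => uu κ')
      (fun κ' _ => huu0 κ') (fun κ' _ => huu1 κ')
    have := mul_le_mul_of_nonneg_left h (sub_nonneg.2 (huu1 (Fin.natAdd Mf K)))
    simpa [hD] using this
  set cfF : Fin Mf → ℝ := fun I => (1 - uu (Fin.castAdd Mc I)) * ∏ K ∈ univ.filter (· < I), uu (Fin.castAdd Mc K) with hcfF
  set A : Fin m → Fin 3 → ℝ := fun x k => if θ x < 1 then
      ((if k = 1 then (w s(s x, p x) : ℝ) else 1 - w s(s x, p x)) * (if k = 2 then (w s(s x, p' x) : ℝ) else 1 - w s(s x, p' x))) / (1 - θ x)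
    else if k = 1 then 1 else 0 with hA
  have hAnn : ∀ x k, 0 ≤ A x k := fun x k => extremeCoeff_nonneg _ _ (w _).2.1 (w _).2.2 (w _).2.1 (w _).2.2 k
  have hA0 : ∀ x, (if θ x < 1 then ((1 - (w s(s x, p x) : ℝ)) * (1 - w s(s x, p' x))) / (1 - θ x) else 0) = A x 0 := by
    intro x; simp only [hA]; simp
  set coef : (Fin m → Fin 3) → ℝ := fun e => ∏ x, A x (e x) with hcoef
  have hcoefnn : ∀ e, 0 ≤ coef e := fun e => prod_nonneg fun x _ => hAnn x (e x)
  set C0 : ℝ := ∏ x, A x 0 with hC0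
  have hC0nn : 0 ≤ C0 := prod_nonneg fun x _ => hAnn x 0
  set Rw : (Fin m → Fin 3) → Finset (Fin n) := fun e =>
    (univ.filter fun i => e i = 1).image p ∪ (univ.filter fun i => e i = 2).image p' with hRw
  have hE0 : (∏ x, (if θ x < 1 then ((1 - (w s(s x, p x) : ℝ)) * (1 - w s(s x, p' x))) / (1 - θ x) else 0)) = C0 :=
    prod_congr rfl fun x _ => hA0 x
  change (∏ x, (if θ x < 1 then ((1 - (w s(s x, p x) : ℝ)) * (1 - w s(s x, p' x))) / (1 - θ x) else 0)) * (∑ I, cfF I + ∑ K, D K) ≤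
    (∏ x, (if θ x < 1 then ((1 - (w s(s x, p x) : ℝ)) * (1 - w s(s x, p' x))) / (1 - θ x) else 0)) +
      ∑ e, (if 3 ≤ (Rw e).card then coef e else 0)
  rw [hE0]
  -- (1) telescoping of the nested forest coefficients
  have htel : ∑ I, cfF I = 1 - ∏ I, uu (Fin.castAdd Mc I) := by
    have h := nestedCoeff_sum (fun I : Fin Mf => 1 - uu (Fin.castAdd Mc I))
    simp only [sub_sub_cancel] at h
    exact h
  -- (2) second-order reduction at class level
  set Cr : Finset (Fin (Mf + Mc)) := univ.filter (fun κ => Mf ≤ (κ : ℕ)) with hCr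
  set F : Finset (Fin (Mf + Mc)) := univ.filter (fun κ => (κ : ℕ) < Mf) with hF
  have hCF : Disjoint Cr F := by
    rw [hCr, hF, disjoint_filter]; intro κ _ h1 h2; exact absurd h2 (not_lt.2 h1)
  have hsumCr : ∀ f : Fin (Mf + Mc) → ℝ, ∑ κ ∈ Cr, f κ = ∑ K : Fin Mc, f (Fin.natAdd Mf K) := by
    intro f
    rw [hCr, sum_filter, Fin.sum_univ_add]
    have h1 : ∑ I : Fin Mf, (if Mf ≤ ((Fin.castAdd Mc I : Fin (Mf + Mc)) : ℕ) then f (Fin.castAdd Mc I) else 0) = 0 :=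
      sum_eq_zero fun I _ => by rw [if_neg (by simp)]
    have h2 : ∑ K : Fin Mc, (if Mf ≤ ((Fin.natAdd Mf K : Fin (Mf + Mc)) : ℕ) then f (Fin.natAdd Mf K) else 0) =
        ∑ K : Fin Mc, f (Fin.natAdd Mf K) := sum_congr rfl fun K _ => by rw [if_pos (by simp)]
    rw [h1, h2, zero_add]
  have hprodF : ∀ f : Fin (Mf + Mc) → ℝ, ∏ κ ∈ F, f κ = ∏ I : Fin Mf, f (Fin.castAdd Mc I) := by
    intro f
    rw [hF, prod_filter, Fin.prod_univ_add]
    have h1 : ∏ I : Fin Mf, (if ((Fin.castAdd Mc I : Fin (Mf + Mc)) : ℕ) < Mf then f (Fin.castAdd Mc I) else 1) =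
        ∏ I : Fin Mf, f (Fin.castAdd Mc I) := prod_congr rfl fun I _ => by rw [if_pos (by simp)]
    have h2 : ∏ K : Fin Mc, (if ((Fin.natAdd Mf K : Fin (Mf + Mc)) : ℕ) < Mf then f (Fin.natAdd Mf K) else 1) = 1 :=
      prod_eq_one fun K _ => by rw [if_neg (by simp)]
    rw [h1, h2, mul_one]
  set AdjSet : Fin Mc → Finset (Fin (Mf + Mc)) := fun K =>
    F.filter (fun J => touch J (Fin.natAdd Mf K)) ∪ Cr.filter (fun J => Fin.natAdd Mf K < J ∧ touch J (Fin.natAdd Mf K)) with hAdjSet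
  have hS1 : ∑ K, D K ≤ ∏ I, uu (Fin.castAdd Mc I) + ∑ K, D K * ∑ J ∈ AdjSet K, (1 - uu J) := by
    have h := supply_second_order_reduction (fun κ => 1 - uu κ) (fun κ => sub_nonneg.2 (huu1 κ)) (fun κ => sub_le_self _ (huu0 κ))
      (fun κ' κ => touch κ' κ) Cr F ∅ hCF (fun κ _ => Or.inl rfl)
    simp only [sub_sub_cancel, sum_empty, add_zero, sdiff_empty] at h
    rw [hsumCr, hsumCr, hprodF] at h
    refine le_trans h (add_le_add le_rfl (le_of_eq (sum_congr rfl fun K _ => ?_)))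
    simp only [hAdjSet]
    rw [sum_union (disjoint_filter_filter hCF.symm)]
  -- (3) reduce to the second-order terms
  suffices hmain : C0 * ∑ K, D K * ∑ J ∈ AdjSet K, (1 - uu J) ≤ ∑ e, (if 3 ≤ (Rw e).card then coef e else 0) by
    rw [htel]
    have := mul_le_mul_of_nonneg_left hS1 hC0nn
    nlinarith
  -- (4) class weights ≤ star sums
  have hΘle : ∀ κ, 1 - uu κ ≤ ∑ i ∈ St κ, θ i := fun κ => one_sub_prod_le_sum (St κ) θ hθ0 hθ1
  have hAdjnn : ∀ K, 0 ≤ ∑ J ∈ AdjSet K, (1 - uu J) := fun K => sum_nonneg fun J _ => sub_nonneg.2 (huu1 J)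
  have h4 : C0 * ∑ K, D K * ∑ J ∈ AdjSet K, (1 - uu J) ≤
      ∑ K, ∑ J ∈ AdjSet K, ∑ i ∈ St (Fin.natAdd Mf K), ∑ j ∈ St J, C0 * (θ i * θ j) := by
    rw [mul_sum]
    refine sum_le_sum fun K _ => ?_
    · have h1 : D K * ∑ J ∈ AdjSet K, (1 - uu J) ≤ (∑ i ∈ St (Fin.natAdd Mf K), θ i) * ∑ J ∈ AdjSet K, ∑ j ∈ St J, θ j := by
        refine mul_le_mul ((hDle K).trans (hΘle _)) (sum_le_sum fun J _ => hΘle J) (hAdjnn K)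
          (sum_nonneg fun i _ => hθ0 i)
      have h2 : (∑ i ∈ St (Fin.natAdd Mf K), θ i) * ∑ J ∈ AdjSet K, ∑ j ∈ St J, θ j =
          ∑ J ∈ AdjSet K, ∑ i ∈ St (Fin.natAdd Mf K), ∑ j ∈ St J, θ i * θ j := by
        rw [mul_sum]
        exact sum_congr rfl fun J _ => by rw [sum_mul_sum]
      calc C0 * (D K * ∑ J ∈ AdjSet K, (1 - uu J)) ≤ C0 * (∑ J ∈ AdjSet K, ∑ i ∈ St (Fin.natAdd Mf K), ∑ j ∈ St J, θ i * θ j) := by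
            rw [← h2]; exact mul_le_mul_of_nonneg_left h1 hC0nn
        _ = ∑ J ∈ AdjSet K, ∑ i ∈ St (Fin.natAdd Mf K), ∑ j ∈ St J, C0 * (θ i * θ j) := by
            rw [mul_sum]; exact sum_congr rfl fun J _ => by rw [mul_sum]; exact sum_congr rfl fun i _ => by rw [mul_sum]
  have hκCr : ∀ K : Fin Mc, Fin.natAdd Mf K ∈ Cr := fun K => by simp [hCr]
  have hJne : ∀ K, ∀ J ∈ AdjSet K, J ≠ Fin.natAdd Mf K ∧ touch J (Fin.natAdd Mf K) := by
    intro K J hJ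
    simp only [hAdjSet, mem_union, mem_filter] at hJ
    rcases hJ with ⟨hJF, ht⟩ | ⟨-, hlt, ht⟩
    · exact ⟨fun h => disjoint_left.1 hCF (hκCr K) (h ▸ hJF), ht⟩
    · exact ⟨ne_of_gt hlt, ht⟩
  refine le_trans h4 ?_
  rw [← hE0]
  exact pairs_supply_le_budget w s p p' cls P P' hP hP' hPP' hnopar hdomF AdjSet hJne

end StarSet

end Summit.CriticalPhenomena.PercolationContinuityZ3.Theorems

end
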